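import Summits.QuantumFields.YangMills.Theorems.ColdStartUniversalityLatticeLangevinLawUnique
import Summits.QuantumFields.YangMills.Theorems.ColdStartUniversalityUniformColdStartMixingRungOfErgodic
import HarnessLib

/-!
# Route `ColdStartUniversality`, crux K_A2 `ColdStartContinuumCauchy` (stmt-QuantumFields-24810): the shared node
# `stub_cesaroLawUnique` of lines «blocknoise_coupling» / «lindeberg_swap» — the cold-start Cesàro value does not
# depend on the realisation (Yamada–Watanabe direction)

Helper file (seat `ym-line-csu-p1`, route-affine).  `cesaroLawUnique`: for every `F`, `γ > 0`, `K`, loop string `os` and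
physical time `T`, any two cold-start strong solutions of the step-`K` SZZ dynamics (on any two probability spaces with flat
Brownian drivers) have the same physical-time Cesàro mean `T⁻¹ ∫₀ᵀ E[∏ avgObs (U(s/ε_K))] ds` — an immediate corollary of
UNIQUENESS IN LAW of cold-start solutions (`coldStart_lawUnique`, …LatticeLangevinLawUnique): the integrands agree for every
`s` (`integral_map`).  Statement = the planner's registered `CesaroLawUnique` (skeleton Lines_lindeberg_swap.lean, shared verbatim
with blocknoise_coupling) with its local abbreviations (`G2`, `su2Rep`, `avSU`, `obsK`, `cesaro`, `IsColdStartSol`) unfolded.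
No definition, no sorry.  RECORD-rung R3 plumbing; this proves nothing about K_A2 itself or the mass gap. -/

set_option autoImplicit false

noncomputable section

namespace Summit.QuantumFields.YangMills.Theorems.ColdStartUniversality

open MeasureTheory ProbabilityTheory intervalIntegral
open scoped NNReal
open Literature.MathematicalPhysics.QuantumFieldTheory
open Literature.MathematicalPhysics.QuantumLattice (fundamentalRep fundamentalLatticeRep continuous_fundamentalRep)
open Literature.MathematicalPhysics.QuantumFieldTheory.Balaban1983to89

/-- **`CesaroLawUnique` (registered stub `stub_cesaroLawUnique` of lines blocknoise_coupling / lindeberg_swap,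
stmt-QuantumFields-24810)**: the cold-start physical-time Cesàro mean of a loop string is the same for all cold-start strong
solutions on all probability spaces. [cite: RevuzYor1999, Ch. IX Thm (1.7)] -/
theorem cesaroLawUnique :
    ∀ (F : T3ContinuumYM3Torus.T3Family) (γ : ℝ), 0 < γ → ∀ (K : ℕ) (os : List (T3ContinuumYM3Torus.ULoop3 F)) (T : ℝ)
      (Ω₁ : Type) (_ : MeasurableSpace Ω₁) (P₁ : Measure Ω₁) (_ : IsProbabilityMeasure P₁)
      (W₁ : ℝ≥0 → Ω₁ → (Edge 3 ((F.P K).sitesPerDir 0) × NoiseIdx 2 → ℝ)) (hW₁ : IsFlatBrownian W₁ P₁)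
      (U₁ : ℝ≥0 → Ω₁ → GaugeConfig 3 ((F.P K).sitesPerDir 0) (Matrix.specialUnitaryGroup (Fin 2) ℂ)),
      ((∀ ω, U₁ 0 ω = fun _ => 1) ∧
        (latticeLangevinDynamics (⟨2, fundamentalRep (Fin 2), continuous_fundamentalRep _,
            Literature.MathematicalPhysics.QuantumLattice.fundamentalRep_injective _,
            Literature.MathematicalPhysics.QuantumLattice.fundamentalRep_mem_unitaryGroup⟩ :
            LatticeRep (Matrix.specialUnitaryGroup (Fin 2) ℂ)) ((γ * (F.P K).eps)⁻¹ / 2)).IsSolution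
          (fundamentalRep (Fin 2)) hW₁.natFiltration P₁ W₁ U₁) →
      ∀ (Ω₂ : Type) (_ : MeasurableSpace Ω₂) (P₂ : Measure Ω₂) (_ : IsProbabilityMeasure P₂)
        (W₂ : ℝ≥0 → Ω₂ → (Edge 3 ((F.P K).sitesPerDir 0) × NoiseIdx 2 → ℝ)) (hW₂ : IsFlatBrownian W₂ P₂)
        (U₂ : ℝ≥0 → Ω₂ → GaugeConfig 3 ((F.P K).sitesPerDir 0) (Matrix.specialUnitaryGroup (Fin 2) ℂ)),
        ((∀ ω, U₂ 0 ω = fun _ => 1) ∧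
          (latticeLangevinDynamics (⟨2, fundamentalRep (Fin 2), continuous_fundamentalRep _,
              Literature.MathematicalPhysics.QuantumLattice.fundamentalRep_injective _,
              Literature.MathematicalPhysics.QuantumLattice.fundamentalRep_mem_unitaryGroup⟩ :
              LatticeRep (Matrix.specialUnitaryGroup (Fin 2) ℂ)) ((γ * (F.P K).eps)⁻¹ / 2)).IsSolution
            (fundamentalRep (Fin 2)) hW₂.natFiltration P₂ W₂ U₂) →
        T⁻¹ * intervalIntegral (fun s : ℝ => MeasureTheory.integral P₁ (fun ω =>
            (os.map fun C => F.avgObs (ExpMeanLog.expMeanLogSU : LoopAverage (Matrix.specialUnitaryGroup (Fin 2) ℂ)) K C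
              (fun b : PBond (F.P K) 0 => U₁ (s / (F.P K).eps).toNNReal ω (b.src, b.dir))).prod)) 0 T volume =
        T⁻¹ * intervalIntegral (fun s : ℝ => MeasureTheory.integral P₂ (fun ω =>
            (os.map fun C => F.avgObs (ExpMeanLog.expMeanLogSU : LoopAverage (Matrix.specialUnitaryGroup (Fin 2) ℂ)) K C
              (fun b : PBond (F.P K) 0 => U₂ (s / (F.P K).eps).toNNReal ω (b.src, b.dir))).prod)) 0 T volume := by
  intro F γ hγ K os T Ω₁ mΩ₁ P₁ hP₁ W₁ hW₁ U₁ hU₁ Ω₂ mΩ₂ P₂ hP₂ W₂ hW₂ U₂ hU₂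
  have hfm := measurable_prodAvgObs_pullback F K os
  have hint : (fun s : ℝ => MeasureTheory.integral P₁ (fun ω =>
      (os.map fun C => F.avgObs (ExpMeanLog.expMeanLogSU : LoopAverage (Matrix.specialUnitaryGroup (Fin 2) ℂ)) K C
        (fun b : PBond (F.P K) 0 => U₁ (s / (F.P K).eps).toNNReal ω (b.src, b.dir))).prod)) =
      fun s : ℝ => MeasureTheory.integral P₂ (fun ω =>
      (os.map fun C => F.avgObs (ExpMeanLog.expMeanLogSU : LoopAverage (Matrix.specialUnitaryGroup (Fin 2) ℂ)) K C
        (fun b : PBond (F.P K) 0 => U₂ (s / (F.P K).eps).toNNReal ω (b.src, b.dir))).prod) := by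
    funext s
    have hm₁ : Measurable (U₁ (s / (F.P K).eps).toNNReal) := (hU₁.2.adapted _).mono (hW₁.natFiltration.le _) le_rfl
    have hm₂ : Measurable (U₂ (s / (F.P K).eps).toNNReal) := (hU₂.2.adapted _).mono (hW₂.natFiltration.le _) le_rfl
    have hlaw := coldStart_lawUnique ((F.P K).sitesPerDir 0) ((γ * (F.P K).eps)⁻¹ / 2) Ω₁ mΩ₁ P₁ hP₁ W₁ hW₁ U₁
      Ω₂ mΩ₂ P₂ hP₂ W₂ hW₂ U₂ hU₁.1 hU₁.2 hU₂.1 hU₂.2 (s / (F.P K).eps).toNNReal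
    rw [← integral_map hm₁.aemeasurable hfm.aestronglyMeasurable,
      ← integral_map hm₂.aemeasurable hfm.aestronglyMeasurable, hlaw]
  rw [hint]

end Summit.QuantumFields.YangMills.Theorems.ColdStartUniversality

end
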